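/-
HONEST FRAMING: certified error envelopes and provably optimal rounding/accumulation schemes for
low-precision formats under stated cost models; every table by two implementations; no hardware or
vendor claims.
-/
import Summits.Ventures.CertifiedArithmetic.LowPrec.OptChainLabelsEff

/-!
# The EFFECTIVE labelled chain law (OPTIMA.md §B, Theorem T9(e)) — part 2: attainment

For EVERY start precision `e₀ ≥ 1` and EVERY add/convert pattern `P = [(π₁, c₁), …, (π_n, c_n)]`
(`c_i = true`: step `i` is a conversion, `x_i = 0`; `false`: an addition) there are nearest
roundings (ties resolved downwards, `TiesDown`) and admissible data realising the pattern with
`acc + Σ x_i = (1 + U_eff) · S_n`, `S_n = 2^E` (`lchain_eff_attained`).  With part 1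
(`exact_le_lchain_eff`) the exact worst case of the relative under-estimation of a labelled chain,
over all nearest roundings and all nonnegative data, is `U_eff / (1 + U_eff)` — conversions into a
format at least as wide as the running sum's effective format are free, and NOTHING ELSE is.

THE WITNESS (built from the back): the running sum entering a suffix `T` of the pattern, with
effective precision `e`, is `2^E (1 + R_e(T))`, `R_e(T)` = the sum of `u_π` over the LOSSY
conversions of the initial conversion-run of `T` (`Rsum`); their precisions decrease strictly and are
`< e`, so this value is a float of `F(e)`.  An exact conversion leaves it alone; a lossy conversion
to `π` receives `2^E (1 + u_π + R_π(T')) = v + u_π 2^E` with `v = 2^E (1 + R_π(T')) ∈ F(π)`, a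
midpoint of `F(π)` sent DOWN to `v` (`fl_midpoint_down`), losing exactly `u_π 2^E`; an addition at
`π` receives `2^E` and adds `x = 2^E (u_π + R_π(T'))`, again the midpoint above `v`, again losing
`u_π 2^E`.  Total loss `U_eff · 2^E`, final value `2^E`.  Under round-to-nearest-EVEN the midpoint
must moreover be the even candidate of the PREVIOUS rounding, which needs a two-bit gap
(`π_{i-1} ≥ π_i + 2`, one bit after the free start value): that is the RNE attainment criterion
certified (not proved) in C21 (`rne_rule`, exact on 3451/3451 rows).

`R4_LabelledChainLawEff` packages bound + attainment Statement-style; `_holds` proves it.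
-/

namespace Summit.Ventures.CertifiedArithmetic.LowPrec.Opt

open Literature.ComputerArithmetic.JeannerodRump2018

/-! ## Patterns, the run sums, the witness -/

/-- `Rsum e T`: the sum of `u_π` over the lossy conversions in the initial conversion-run of the
pattern `T` (entries `(π, isConversion)`), entered with effective precision `e`. -/
def Rsum : ℕ → List (ℕ × Bool) → ℚ
  | _, [] => 0
  | e, (π, true) :: T => if e ≤ π then Rsum e T else unitRoundoff π + Rsum π T
  | _, (_, false) :: _ => 0

/-- `ueffP e P`: the effective unit-roundoff sum of the PATTERN `P` (additions and lossy
conversions), entered with effective precision `e` — the pattern version of `ueff`. -/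
def ueffP : ℕ → List (ℕ × Bool) → ℚ
  | _, [] => 0
  | e, (π, true) :: T => if e ≤ π then ueffP e T else unitRoundoff π + ueffP π T
  | _, (π, false) :: T => unitRoundoff π + ueffP π T

/-- The witness chain of the pattern `P` at scale `2^E`, step `π` rounding with `fl π`:
conversions add `0`, an addition at `π` followed by `T` adds `2^E (u_π + Rsum π T)`. -/
def witSteps (fl : ℕ → ℚ → ℚ) (E : ℤ) : List (ℕ × Bool) → List LStep
  | [] => []
  | (π, true) :: T => ⟨π, fl π, 0⟩ :: witSteps fl E T
  | (π, false) :: T => ⟨π, fl π, (2 : ℚ) ^ E * (unitRoundoff π + Rsum π T)⟩ :: witSteps fl E T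

/-- `0 ≤ Rsum`. -/
theorem Rsum_nonneg : ∀ (e : ℕ) (P : List (ℕ × Bool)), 0 ≤ Rsum e P
  | _, [] => le_rfl
  | e, (π, true) :: T => by
      simp only [Rsum]
      split_ifs
      · exact Rsum_nonneg e T
      · linarith [unitRoundoff_nonneg π, Rsum_nonneg π T]
  | _, (_, false) :: _ => le_rfl

/-- DYADIC STRUCTURE OF THE RUN SUM: entered with precision `k+1`, `Rsum` is `N / 2^k` with
`N < 2^k` (its lossy conversions have strictly decreasing precisions `≤ k`). -/
theorem Rsum_repr : ∀ (P : List (ℕ × Bool)) (k : ℕ), (∀ q ∈ P, 1 ≤ q.1) →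
    ∃ N : ℕ, N < 2 ^ k ∧ Rsum (k + 1) P = (N : ℚ) / 2 ^ k
  | [], k, _ => ⟨0, Nat.two_pow_pos k, by simp [Rsum]⟩
  | (π, false) :: T, k, _ => ⟨0, Nat.two_pow_pos k, by simp [Rsum]⟩
  | (π, true) :: T, k, hP => by
      have hπ : 1 ≤ π := hP (π, true) (by simp)
      have hT : ∀ q ∈ T, 1 ≤ q.1 := fun q hq => hP q (by simp [hq])
      by_cases h : k + 1 ≤ π
      · obtain ⟨N, hN, hR⟩ := Rsum_repr T k hT
        exact ⟨N, hN, by simp only [Rsum, if_pos h]; exact hR⟩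
      · obtain ⟨j, rfl⟩ : ∃ j, π = j + 1 := ⟨π - 1, by omega⟩
        obtain ⟨m, rfl⟩ : ∃ m, k = m + (j + 1) := ⟨k - (j + 1), by omega⟩
        obtain ⟨N', hN', hR'⟩ := Rsum_repr T j hT
        refine ⟨(1 + 2 * N') * 2 ^ m, ?_, ?_⟩
        · have h1 : 1 + 2 * N' < 2 ^ (j + 1) := by rw [pow_succ]; omega
          calc (1 + 2 * N') * 2 ^ m < 2 ^ (j + 1) * 2 ^ m :=
                Nat.mul_lt_mul_of_pos_right h1 (Nat.two_pow_pos m)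
            _ = 2 ^ (m + (j + 1)) := by rw [← pow_add, add_comm]
        · simp only [Rsum, if_neg h]
          rw [hR']
          unfold unitRoundoff
          push_cast
          rw [pow_add, pow_succ]
          field_simp
          ring

/-- THE WITNESS VALUES ARE FLOATS: `2^E (1 + Rsum e P) ∈ F(e)` (`e ≥ 1`, `2^(E+1-e) ≥ 2^emin`). -/
theorem isFloat_witVal {emin E : ℤ} {e : ℕ} (he : 1 ≤ e) (heE : emin + e ≤ E + 1)
    (P : List (ℕ × Bool)) (hP : ∀ q ∈ P, 1 ≤ q.1) :
    IsFloat e emin ((2 : ℚ) ^ E * (1 + Rsum e P)) := by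
  obtain ⟨k, rfl⟩ : ∃ k, e = k + 1 := ⟨e - 1, by omega⟩
  obtain ⟨N, hN, hR⟩ := Rsum_repr P k hP
  have hNz : (N : ℤ) < 2 ^ k := by exact_mod_cast hN
  refine ⟨2 ^ k + N, E - k, ?_, by omega, ?_⟩
  · rw [abs_of_nonneg (by positivity), pow_succ]
    linarith
  · rw [hR, zpow_sub₀ (by norm_num : (2 : ℚ) ≠ 0), zpow_natCast]
    push_cast
    field_simp

/-- `2^E ≤` the witness value. -/
theorem two_zpow_le_witVal (E : ℤ) (e : ℕ) (P : List (ℕ × Bool)) :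
    (2 : ℚ) ^ E ≤ (2 : ℚ) ^ E * (1 + Rsum e P) := by
  have h0 : (0 : ℚ) < (2 : ℚ) ^ E := zpow_pos (by norm_num) _
  nlinarith [Rsum_nonneg e P]

/-- THE WITNESS COMPUTATION ENDS AT `2^E`: every addition and every lossy conversion is a midpoint
resolved downwards, every exact conversion is the identity. -/
theorem lchainEval_witSteps {emin E : ℤ} {fl : ℕ → ℚ → ℚ}
    (hfl : ∀ π, IsRoundNearest π emin (fl π) ∧ TiesDown π emin (fl π)) :
    ∀ (P : List (ℕ × Bool)) (e : ℕ), 1 ≤ e → emin + e ≤ E + 1 →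
      (∀ q ∈ P, 1 ≤ q.1 ∧ emin + q.1 ≤ E + 1) →
      lchainEval ((2 : ℚ) ^ E * (1 + Rsum e P)) (witSteps fl E P) = (2 : ℚ) ^ E
  | [], e, _, _, _ => by simp [Rsum, witSteps]
  | (π, true) :: T, e, he, heE, hP => by
      obtain ⟨hπ, hπE⟩ := hP (π, true) (by simp)
      have hT : ∀ q ∈ T, 1 ≤ q.1 ∧ emin + q.1 ≤ E + 1 := fun q hq => hP q (by simp [hq])
      have hT1 : ∀ q ∈ T, 1 ≤ q.1 := fun q hq => (hT q hq).1
      simp only [witSteps, lchainEval_cons, add_zero]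
      by_cases h : e ≤ π
      · rw [show Rsum e ((π, true) :: T) = Rsum e T by simp [Rsum, h],
          fl_eq_self (hfl π).1 (PTree.isFloat_mono h (isFloat_witVal he heE T hT1))]
        exact lchainEval_witSteps hfl T e he heE hT
      · rw [show Rsum e ((π, true) :: T) = unitRoundoff π + Rsum π T by simp [Rsum, h],
          show (2 : ℚ) ^ E * (1 + (unitRoundoff π + Rsum π T))
            = (2 : ℚ) ^ E * (1 + Rsum π T) + (2 : ℚ) ^ E * unitRoundoff π by ring,
          fl_midpoint_down (hfl π).1 (hfl π).2 (isFloat_witVal hπ hπE T hT1)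
            (two_zpow_le_witVal E π T)]
        exact lchainEval_witSteps hfl T π hπ hπE hT
  | (π, false) :: T, e, _, _, hP => by
      obtain ⟨hπ, hπE⟩ := hP (π, false) (by simp)
      have hT : ∀ q ∈ T, 1 ≤ q.1 ∧ emin + q.1 ≤ E + 1 := fun q hq => hP q (by simp [hq])
      have hT1 : ∀ q ∈ T, 1 ≤ q.1 := fun q hq => (hT q hq).1
      simp only [witSteps, lchainEval_cons, Rsum]
      rw [show (2 : ℚ) ^ E * (1 + 0) + (2 : ℚ) ^ E * (unitRoundoff π + Rsum π T)
          = (2 : ℚ) ^ E * (1 + Rsum π T) + (2 : ℚ) ^ E * unitRoundoff π by ring,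
        fl_midpoint_down (hfl π).1 (hfl π).2 (isFloat_witVal hπ hπE T hT1)
          (two_zpow_le_witVal E π T)]
      exact lchainEval_witSteps hfl T π hπ hπE hT

/-- THE WITNESS SUMMANDS add up to `2^E (ueffP - Rsum)` (so start value plus summands is
`2^E (1 + ueffP)`). -/
theorem xsum_witSteps (fl : ℕ → ℚ → ℚ) (E : ℤ) :
    ∀ (P : List (ℕ × Bool)) (e : ℕ),
      xsum (witSteps fl E P) = (2 : ℚ) ^ E * (ueffP e P - Rsum e P)
  | [], e => by simp [Rsum, ueffP, witSteps]
  | (π, true) :: T, e => by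
      by_cases h : e ≤ π
      · simp only [Rsum, ueffP, witSteps, xsum_cons, zero_add, if_pos h]
        exact xsum_witSteps fl E T e
      · simp only [Rsum, ueffP, witSteps, xsum_cons, zero_add, if_neg h]
        rw [xsum_witSteps fl E T π]
        ring
  | (π, false) :: T, e => by
      simp only [Rsum, ueffP, witSteps, xsum_cons]
      rw [xsum_witSteps fl E T π]
      ring

/-- The witness chain realises the pattern: step kinds (`x = 0` iff conversion) and precisions. -/
theorem map_witSteps (fl : ℕ → ℚ → ℚ) (E : ℤ) :
    ∀ (P : List (ℕ × Bool)), (witSteps fl E P).map (fun s => (s.prec, decide (s.x = 0))) = P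
  | [] => rfl
  | (π, true) :: T => by simp [witSteps, map_witSteps fl E T]
  | (π, false) :: T => by
      have hx : (2 : ℚ) ^ E * (unitRoundoff π + Rsum π T) ≠ 0 := by
        have h0 : (0 : ℚ) < (2 : ℚ) ^ E := zpow_pos (by norm_num) _
        have hu : 0 < unitRoundoff π := by unfold unitRoundoff; positivity
        have := Rsum_nonneg π T
        positivity
      simp [witSteps, map_witSteps fl E T, hx]

/-- On the witness chain the semantic `ueff` is the pattern's `ueffP`. -/
theorem ueff_witSteps (fl : ℕ → ℚ → ℚ) (E : ℤ) :
    ∀ (P : List (ℕ × Bool)) (e : ℕ), ueff e (witSteps fl E P) = ueffP e P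
  | [], _ => rfl
  | (π, true) :: T, e => by
      simp only [witSteps, ueff_cons, ueffP, true_and]
      split_ifs
      · exact ueff_witSteps fl E T e
      · rw [ueff_witSteps fl E T π]
  | (π, false) :: T, e => by
      have hx : ¬ ((2 : ℚ) ^ E * (unitRoundoff π + Rsum π T) = 0 ∧ e ≤ π) := by
        intro h
        have h0 : (0 : ℚ) < (2 : ℚ) ^ E := zpow_pos (by norm_num) _
        have hu : 0 < unitRoundoff π := by unfold unitRoundoff; positivity
        have := Rsum_nonneg π T
        nlinarith [h.1]
      simp only [witSteps, ueff_cons, ueffP, if_neg hx]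
      rw [ueff_witSteps fl E T π]

/-- The witness steps are admissible (`LStep.OK`): precisions `≥ 1`, nearest maps, nonnegative
grid summands (`x = (v + u_π 2^E) - 2^E` with `v`, `u_π 2^E`, `2^E` floats). -/
theorem witSteps_ok {emin E : ℤ} {fl : ℕ → ℚ → ℚ} (hfl : ∀ π, IsRoundNearest π emin (fl π)) :
    ∀ (P : List (ℕ × Bool)), (∀ q ∈ P, 1 ≤ q.1 ∧ emin + q.1 ≤ E) →
      ∀ s ∈ witSteps fl E P, s.OK emin
  | [], _, s, hs => by simp [witSteps] at hs
  | (π, true) :: T, hP, s, hs => by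
      have hT : ∀ q ∈ T, 1 ≤ q.1 ∧ emin + q.1 ≤ E := fun q hq => hP q (by simp [hq])
      simp only [witSteps, List.mem_cons] at hs
      rcases hs with rfl | hs
      · exact ⟨(hP (π, true) (by simp)).1, hfl π, le_rfl, isGrid_zero emin⟩
      · exact witSteps_ok hfl T hT s hs
  | (π, false) :: T, hP, s, hs => by
      obtain ⟨hπ, hπE⟩ := hP (π, false) (by simp)
      have hT : ∀ q ∈ T, 1 ≤ q.1 ∧ emin + q.1 ≤ E := fun q hq => hP q (by simp [hq])
      have hT1 : ∀ q ∈ T, 1 ≤ q.1 := fun q hq => (hT q hq).1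
      simp only [witSteps, List.mem_cons] at hs
      rcases hs with rfl | hs
      · refine ⟨hπ, hfl π, ?_, ?_⟩
        · have h0 : (0 : ℚ) < (2 : ℚ) ^ E := zpow_pos (by norm_num) _
          have := Rsum_nonneg π T
          have := unitRoundoff_nonneg π
          positivity
        · have hv : IsGrid emin ((2 : ℚ) ^ E * (1 + Rsum π T)) :=
            isGrid_of_isFloat (isFloat_witVal hπ (by omega) T hT1)
          have hone : IsGrid emin ((2 : ℚ) ^ E * (1 + Rsum π [])) :=
            isGrid_of_isFloat (isFloat_witVal hπ (by omega) [] (by simp))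
          simp only [Rsum, add_zero, mul_one] at hone
          have hu : IsGrid emin ((2 : ℚ) ^ E * unitRoundoff π) :=
            isGrid_of_isFloat (isFloat_zpow_mul_unitRoundoff hπ hπE)
          obtain ⟨A, hA⟩ := hv
          obtain ⟨B, hB⟩ := hone
          obtain ⟨C, hC⟩ := hu
          refine ⟨A + C - B, ?_⟩
          calc (2 : ℚ) ^ E * (unitRoundoff π + Rsum π T)
              = (2 : ℚ) ^ E * (1 + Rsum π T) + (2 : ℚ) ^ E * unitRoundoff π - (2 : ℚ) ^ E := by
                ring
            _ = (A : ℚ) * (2 : ℚ) ^ emin + (C : ℚ) * (2 : ℚ) ^ emin - (B : ℚ) * (2 : ℚ) ^ emin := by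
                rw [hA, hC, ← hB]
            _ = ((A + C - B : ℤ) : ℚ) * (2 : ℚ) ^ emin := by push_cast; ring
      · exact witSteps_ok hfl T hT s hs

/-- THE EFFECTIVE LAW IS ATTAINED (Theorem T9(e), sharpness): for every start precision `e₀ ≥ 1`
and every add/convert pattern `P` with precisions `≥ 1`, at any scale `2^E` clear of underflow,
ties-downward nearest roundings and the witness data give `S_n = 2^E` and
`acc + Σ x_i = (1 + U_eff) · S_n` exactly. -/
theorem lchain_eff_attained {emin E : ℤ} {fl : ℕ → ℚ → ℚ}
    (hfl : ∀ π, IsRoundNearest π emin (fl π) ∧ TiesDown π emin (fl π))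
    {e₀ : ℕ} (he₀ : 1 ≤ e₀) (he₀E : emin + e₀ ≤ E)
    (P : List (ℕ × Bool)) (hP : ∀ q ∈ P, 1 ≤ q.1 ∧ emin + q.1 ≤ E) :
    IsFloat e₀ emin ((2 : ℚ) ^ E * (1 + Rsum e₀ P)) ∧
    (∀ s ∈ witSteps fl E P, s.OK emin) ∧
    lchainEval ((2 : ℚ) ^ E * (1 + Rsum e₀ P)) (witSteps fl E P) = (2 : ℚ) ^ E ∧
    (2 : ℚ) ^ E * (1 + Rsum e₀ P) + xsum (witSteps fl E P)
      = (1 + ueff e₀ (witSteps fl E P)) * lchainEval ((2 : ℚ) ^ E * (1 + Rsum e₀ P))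
          (witSteps fl E P) := by
  have hP1 : ∀ q ∈ P, 1 ≤ q.1 := fun q hq => (hP q hq).1
  have hP' : ∀ q ∈ P, 1 ≤ q.1 ∧ emin + q.1 ≤ E + 1 :=
    fun q hq => ⟨(hP q hq).1, by linarith [(hP q hq).2]⟩
  have hev := lchainEval_witSteps hfl P e₀ he₀ (by omega) hP'
  refine ⟨isFloat_witVal he₀ (by omega) P hP1, witSteps_ok (fun π => (hfl π).1) P hP, hev, ?_⟩
  rw [hev, ueff_witSteps, xsum_witSteps fl E P e₀]
  ring

/-- A family of ties-downward nearest maps, one per precision. -/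
theorem exists_tiesDown_family (emin : ℤ) :
    ∃ fl : ℕ → ℚ → ℚ, ∀ π, IsRoundNearest π emin (fl π) ∧ TiesDown π emin (fl π) := by
  choose fl h using fun π => exists_roundNearest_tiesDown π emin
  exact ⟨fl, h⟩

/-! ## Statement-style packaging -/

/-- R4-style Prop (OPTIMA.md T9(e)): THE EFFECTIVE LABELLED CHAIN LAW IS THE EXACT WORST CASE.
(1) For every admissible labelled chain from a start value `acc ∈ F(e₀)`, `acc ≥ 0`:
`acc + Σ x_i ≤ (1 + ueff e₀ steps) · S_n`.  (2) For every `e₀ ≥ 1`, every add/convert pattern `P`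
(precisions `≥ 1`) and every scale `E` with `emin + π ≤ E` throughout, some admissible chain
realising `P` (nearest roundings, `x_i = 0` exactly at the conversions) from some `acc ∈ F(e₀)`
has `S_n = 2^E` and `acc + Σ x_i = (1 + ueffP e₀ P) · S_n`. -/
def R4_LabelledChainLawEff : Prop :=
  (∀ (emin : ℤ) (e₀ : ℕ) (ss : List LStep) (acc : ℚ), 0 ≤ acc → IsFloat e₀ emin acc →
      (∀ s ∈ ss, s.OK emin) → acc + xsum ss ≤ (1 + ueff e₀ ss) * lchainEval acc ss) ∧
  (∀ (emin E : ℤ) (e₀ : ℕ), 1 ≤ e₀ → emin + e₀ ≤ E →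
    ∀ P : List (ℕ × Bool), (∀ q ∈ P, 1 ≤ q.1 ∧ emin + q.1 ≤ E) →
      ∃ (acc : ℚ) (ws : List LStep),
        ws.map (fun s => (s.prec, decide (s.x = 0))) = P ∧ IsFloat e₀ emin acc ∧
        (∀ s ∈ ws, s.OK emin) ∧ lchainEval acc ws = (2 : ℚ) ^ E ∧
        acc + xsum ws = (1 + ueffP e₀ P) * lchainEval acc ws)

/-- `R4_LabelledChainLawEff` holds. -/
theorem R4_LabelledChainLawEff_holds : R4_LabelledChainLawEff := by
  refine ⟨fun emin e₀ ss acc hacc0 hacc hss => exact_le_lchain_eff ss acc hacc0 hacc hss, ?_⟩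
  intro emin E e₀ he₀ he₀E P hP
  obtain ⟨fl, hfl⟩ := exists_tiesDown_family emin
  obtain ⟨hacc, hok, hev, heq⟩ := lchain_eff_attained hfl he₀ he₀E P hP
  refine ⟨_, witSteps fl E P, map_witSteps fl E P, hacc, hok, hev, ?_⟩
  rw [← ueff_witSteps fl E P e₀]
  exact heq

end Summit.Ventures.CertifiedArithmetic.LowPrec.Opt
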